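import Mathlib
import Literature.Computability.Cryptography.QubitRegister
import Literature.Computability.Cryptography.QuantumCircuit
import Literature.Computability.Cryptography.ClassBQP
import Literature.Computability.Cryptography.QuantumTuringMachine
import Literature.Computability.Complexity.Classes
import Literature.Computability.Complexity.ProbabilisticClasses
import Literature.Computability.Complexity.Counting
import Literature.Computability.Complexity.Space
import Literature.Computability.Cryptography.Shor
import Literature.Computability.QuantumComplexity.ClassicalClasses
import HarnessLib
import HarnessLib.Audit

-- provenance: harness21/H21/H21/Statements/QuantumAdvantage/BQP.lean @ 576a5e9 (interim HEAD d8f2665); M5 mechanical rewrite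
/-!
# Quantum advantage: `BQP` versus the classical classes (family `quantum-advantage`)

Trunk CryptoQuantFine, outline §3 `QuantumAdvantage/BQP`. This statement file records, in the
family namespace `Literature.QuantumAdvantage`, the peak of the family and its known-theorem satellites:

* **quantum-advantage.S01** `BQPNeBPP : Prop := BQP ≠ BPP` (the peak, open), with the literal
  reformulation `bqpNeBPP_iff` ("some language is in `BQP` and not in `BPP`");
* **quantum-advantage.S02** `BQPEqBPP : Prop := BQP = BPP` (the negation summit, open);
* **quantum-advantage.S06** the sandwich `P ⊆ BPP ⊆ BQP ⊆ PP ⊆ PSPACE` (`BPP_subset_BQP`,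
  `BQP_subset_PP`, `bqp_containments`; Bernstein–Vazirani 1997 §8, Adleman–DeMarrais–Huang 1997);
* **quantum-advantage.S26** robustness of `BQP`: error reduction `BQPWith_eq_BQP` and gate-set
  independence `BQPOver_eq_BQP` (Solovay–Kitaev / Dawson–Nielsen + Bernstein–Vazirani);
* **quantum-advantage.S08** universality of Clifford+T and of `{H, T, CNOT}` at the placement
  level (`cliffordT_generatesDenselyModPhase`, `hTCnot_generatesDenselyModPhase`; Boykin et al.
  1999, Nielsen–Chuang §4.5.3);
* **quantum-advantage.S27** `bqpNeBPP_of_FACT_not_mem_BPP : FACT ∉ BPP → BQP ≠ BPP` (real proof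
  from Shor's theorem `Literature.Computability.Cryptography.FACT_mem_BQP`, pqc.S06).

## Mathlib / H21 dependencies

Mathlib has no complexity classes, classical or quantum, and no quantum gates (searched: `BQP`,
`BPP`, `PSPACE`, `qubit`, `Clifford`, `SolovayKitaev` — no hits besides
`Turing.TM2ComputableInPolyTime`). Used from Mathlib: `Set`, `Language`, `Dense`,
`Subgroup.closure`, `Matrix.unitaryGroup`, the matrix topology
(`Mathlib.Topology.Instances.Matrix`, imported through `QubitRegister`). Everything else is the accepted H21 prelude:
`Literature.Computability.Cryptography.BQP`, `BQPWith`, `BQPOver`, `cliffordT`, `CliffordTOp`, `placements`,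
`placeGate`, `GeneratesDenselyModPhase`, `QGateSet.IsUnitary/IsUniversal/IsInverseClosed`
(Q1–Q3), `polyTimeComputableComplex` (Q8), `Literature.Computability.Complexity.Classes.P`, `BPP`, `PP`, `PSPACE` (G01),
`Literature.Computability.QuantumComplexity.FACT`, `Literature.Computability.Cryptography.FACT_mem_BQP` (pqc.S06). The inclusions `P_subset_BPP` (G01),
`Literature.Computability.QuantumComplexity.PP_subset_PSPACE`, `BPP_subset_PSPACE` (accepted `ClassicalClasses`) and
the error-reduction lemma `Literature.Computability.Cryptography.BQP_eq_BQPWith` (Q3) are REUSED, not redeclared.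

## Design notes

* Open problems S01/S02 are `def … : Prop` only (conventions); S06, S08, S26 are theorems in
  print, stated with `sorry` proofs; S27 and `bqpNeBPP_iff` have real proofs (the latter modulo
  `BPP_subset_BQP`).
* **S26, scope.** The inventory text lists three robustness properties: error reduction
  (`BQPWith_eq_BQP`), independence of the finite universal gate set (`BQPOver_eq_BQP`) and the
  principle of deferred measurement. The last is NOT formalised: the circuit syntax `QCircuit`
  of Q2 has no intermediate measurements (a circuit is a list of unitary gate placements followed
  by one final measurement), so deferred measurement is built into the model rather than a
  theorem about it.
* **S26, universality hypothesis.** `BQPOver_eq_BQP` assumes the gate alphabet `G.Op` is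
  *finite* (as in the inventory text; without it a uniform family over infinitely many gates
  can encode an undecidable language in the gate index) and Q1's *placement-level*
  `QGateSet.IsUniversal G` (for all large `n`, the placements of the gates of `G` on `n` wires
  generate `U(2^n)` densely modulo phase), together with unitarity, inverse-closedness
  (`QGateSet.IsInverseClosed`, what Solovay–Kitaev needs) and polynomial-time computability of
  the entries (`polyTimeComputableComplex`, what Bernstein–Vazirani need to keep uniformity).
  This is NOT Wave0's `Literature.Computability.QuantumComplexity.IsUniversalGateSet`, which concerns a finite
  inverse-closed subset of a *fixed* `Matrix.specialUnitaryGroup n ℂ` and cannot express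
  placements of few-qubit gates on registers of varying size. *Bridge (remark only, not
  claimed as a lemma):* for `G` finite, unitary, inverse-closed and universal, and `n ≥ n₀`, the
  set of `SU(2^n)`-projections `(det M)^{-1/2^n} • M` of `M ∈ placements G n` (all `2^n`-th roots)
  is an `IsUniversalGateSet` in `SU(QReg n)`; this is how `solovay_kitaev` (S07) enters the
  proof of `BQPOver_eq_BQP`.
* **S08.** The inventory text is about `{H, T, CNOT}`; H21's `cliffordT` is `{H, S, T, CNOT}`
  (`S = T²` is redundant). We state both: `cliffordT_generatesDenselyModPhase` for the gate set
  `BQP` is built on, and the literal version `hTCnot_generatesDenselyModPhase` for the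
  placements of the gates `≠ S` (`hTCnotPlacements`).

* **Imports (wi-10707, 2026-08-15).** `Literature.Computability.QuantumComplexity.QuantumAdvantageWave0`
  was imported but never used in this file (Wave0's `IsUniversalGateSet` / `solovay_kitaev` appear
  in the remarks above only); it is dropped so that the unproved facts of Wave0 and of its own cone
  (`SolovayKitaev.*` → `QuantumLattice.GaugeGroups` → `QuantumFieldTheory.ConstructiveQFTWave0`)
  leave the import cone of this file and of its 441 transitive importers. `import Mathlib` is now
  EXPLICIT: the whole of Mathlib used to arrive here only through Wave0 / `SolovayKitaev.Basic` /
  `Cryptography.PQCWave0`, and 227 downstream modules have no other whole-Mathlib import.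
  `Literature.Computability.Cryptography.Shor` is equally unused in this file but is KEPT for now:
  the route files `Summits/QuantumAdvantage/QuantumAdvantage/Theses/{Shor,MobiusLadder,CircuitLB}.lean`
  name `FACT`, `FACT_mem_BQP`, `factoring_mem_FBQP` and reach `Cryptography.Shor` only through
  `Summits.QuantumAdvantage.Statement → this file`; it can be dropped once those routes import
  `Literature.Computability.Cryptography.Shor` themselves.

## References

* E. Bernstein, U. Vazirani, *Quantum complexity theory*, SIAM J. Comput. 26 (1997), §8
  (`P ⊆ BPP ⊆ BQP ⊆ P^{#P} ⊆ PSPACE`, error reduction).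
* L. Adleman, J. DeMarrais, M.-D. Huang, *Quantum computability*, SIAM J. Comput. 26 (1997)
  (`BQP ⊆ PP`).
* P. O. Boykin, T. Mor, M. Pulver, V. Roychowdhury, F. Vatan, *On universal and fault-tolerant
  quantum computing*, FOCS 1999 (universality of `{H, T, CNOT}`).
* M. A. Nielsen, I. L. Chuang, *Quantum Computation and Quantum Information* (2000), §4.4
  (deferred measurement), §4.5.3 (a discrete universal set), App. 3 (Solovay–Kitaev).
* C. M. Dawson, M. A. Nielsen, *The Solovay–Kitaev algorithm*, QIC 6 (2006), Thm. 1.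
* P. W. Shor, *Polynomial-time algorithms for prime factorization and discrete logarithms on a
  quantum computer*, SIAM J. Comput. 26 (1997).
* summits/fw-bqp/SUMMIT.md, summits/fw-bqp-neg (family summits).
-/

noncomputable section

namespace Literature.Computability.QuantumComplexity

open _root_.Computability Complexity Complexity.Classes Cryptography

/-! ### quantum-advantage.S06: the sandwich `P ⊆ BPP ⊆ BQP ⊆ PP ⊆ PSPACE` -/

/-- `BPP ⊆ BQP`: a probabilistic polynomial-time machine is simulated by a uniform Clifford+T
family that prepares its coins with Hadamard gates (`H|0⟩` measured is a fair coin) and runs the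
deterministic part reversibly. [Bernstein–Vazirani 1997, §8 (`BPP ⊆ BQP`); Nielsen–Chuang
§4.5.5] [cite: BernsteinVazirani1997, §8 ( BPP ⊆ BQP] -/
def BPP_subset_BQP : Prop :=
  BPP ⊆ BQP

/-- `BQP ⊆ PP`: the acceptance amplitude of a uniform Clifford+T family is a `GapP` function
divided by a power of `√2`, whence a majority-vote polynomial-time simulation.
[Adleman–DeMarrais–Huang 1997 (`BQP ⊆ PP`); Bernstein–Vazirani 1997, §8 (`BQP ⊆ P^{#P}`);
Fortnow–Rogers 1999] [cite: AdlemanDeMarraisHuang1997, ( BQP ⊆ PP] -/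
def BQP_subset_PP : Prop :=
  BQP ⊆ PP

/-- **quantum-advantage.S06** (Bernstein–Vazirani 1997, §8; Adleman–DeMarrais–Huang 1997).
The classical sandwich around `BQP`: `P ⊆ BPP ⊆ BQP ⊆ PP ⊆ PSPACE`. Assembled from
`Literature.Computability.Complexity.P_subset_BPP`, `BPP_subset_BQP`, `BQP_subset_PP` and the accepted
`Literature.Computability.QuantumComplexity.PP_subset_PSPACE`. [cite: BernsteinVazirani1997, §8] -/
def bqp_containments : Prop :=
  P ⊆ BPP ∧ BPP ⊆ BQP ∧ BQP ⊆ PP ∧ PP ⊆ PSPACE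

/- interim proof relied on results that are now named facts (D-0014); demoted to a fact by the M5 import, proof preserved:
:=
  ⟨P_subset_BPP, BPP_subset_BQP, BQP_subset_PP, PP_subset_PSPACE⟩
-/

/-- `BQP ⊆ PSPACE` (corollary of the sandwich). [Bernstein–Vazirani 1997, §8] [cite: BernsteinVazirani1997, §8] -/
def BQP_subset_PSPACE : Prop :=
  BQP ⊆ PSPACE

/- interim proof relied on results that are now named facts (D-0014); demoted to a fact by the M5 import, proof preserved:
:=
  BQP_subset_PP.trans PP_subset_PSPACE
-/

/-! ### quantum-advantage.S01 / S02: the peak and its negation -/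

/-- OPEN CONJECTURE — **quantum-advantage.S02** (negation summit; summits/fw-bqp-neg)
[status: open]. "`BQP = BPP`": every language decided with bounded error by a poly-time uniform
quantum circuit family is decided with bounded error by a probabilistic polynomial-time Turing
machine. An open statement, not literature debt: neither a proof nor a disproof is in print, so no
`BQPEqBPP_holds` is to be expected (its negation is literally the summit `QuantumAdvantage`, see
`BQPEqBPPIff.lean`). [folklore] -/
@[conjecture] def BQPEqBPP : Prop :=
  BQP = BPP

/-! ### quantum-advantage.S27: Shor ⇒ conditional separation -/

/-! ### quantum-advantage.S26: robustness of BQP -/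

/-- **quantum-advantage.S26** (error reduction; Bernstein–Vazirani 1997, §8; Nielsen–Chuang
§4.5.5; Watrous 2009, §III.1). For every constant error bound `0 < ε < 1/2`, the class of
languages decided with two-sided error `ε` by uniform Clifford+T families is `BQP` (majority
vote over parallel repetitions and a Chernoff bound). This is the prelude lemma
`Literature.Computability.Cryptography.BQP_eq_BQPWith` under the inventory id. [cite: BernsteinVazirani1997, §8] -/
def BQPWith_eq_BQP : Prop :=
  ∀ {ε : ℝ} (h0 : 0 < ε) (h : ε < 1 / 2),
    BQPWith cliffordT ε = BQP

/- interim proof relied on results that are now named facts (D-0014); demoted to a fact by the M5 import, proof preserved: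
:=
  BQP_eq_BQPWith h0 h
-/

/-- **quantum-advantage.S26** (independence of the finite universal gate set;
Bernstein–Vazirani 1997, §8; Nielsen–Chuang §4.5 and App. 3; Dawson–Nielsen 2006, Thm. 1).
Let `G` be a *finite* gate set (finite, encodable alphabet `G.Op`) whose gates are unitary with
polynomial-time computable entries, which is inverse-closed and universal at the placement level
(`QGateSet.IsUniversal`: for all large `n` the placements of its gates generate `U(2^n)` densely
modulo phase). Then `BQPOver G = BQP`: uniform poly-size families over `G` and over Clifford+T
decide the same languages with error `1/3`. Finiteness is essential: with infinitely many gates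
a uniform family could hide an undecidable oracle in the gate index. (Proof route: each gate of
one set is compiled by
the Solovay–Kitaev algorithm, `solovay_kitaev` (S07) applied to the `SU`-projections of the
placements, into a word of length `polylog(1/δ)` over the other with accuracy `δ = 1/poly`,
uniformly because the entries are polynomial-time computable; errors add sub-additively; then
error reduction.) The hypothesis is Q1's placement-level universality, NOT Wave0's
fixed-dimension `IsUniversalGateSet` (see the module docstring for the bridge). Deferred
measurement, the third robustness property of the inventory text, is not formalised (no
intermediate measurements in the circuit syntax). [cite: BernsteinVazirani1997, §8] -/
def BQPOver_eq_BQP : Prop :=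
  ∀ (G : QGateSet) [Finite G.Op] [Encodable G.Op] (hU : G.IsUnitary) (huniv : G.IsUniversal) (hinv : G.IsInverseClosed) (hcomp : ∀ (g : G.Op) (i j : QReg (G.arity g)), G.mat g i j ∈ polyTimeComputableComplex),
    BQPOver G = BQP

/-! ### quantum-advantage.S08: universality of Clifford+T and of `{H, T, CNOT}` -/

/-- **quantum-advantage.S08** (Boykin–Mor–Pulver–Roychowdhury–Vatan 1999; Nielsen–Chuang
§4.5.3, with §4.5.2 for the reduction to two-level/one-qubit+CNOT gates). For every `n ≥ 1`,
the placements of the Clifford+T gates `{H, S, T, CNOT}` on `n` wires generate a dense subgroup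
of `U(2^n)` modulo global phase. In particular `cliffordT.IsUniversal`
(`cliffordT_isUniversal`). [cite: BoykinMorPulverRoychowdhuryVatan1999] -/
def cliffordT_generatesDenselyModPhase : Prop :=
  ∀ n, 1 ≤ n → GeneratesDenselyModPhase n (placements cliffordT n)

/-- Clifford+T is universal at the placement level (with threshold `n₀ = 1`).
[Boykin et al. 1999; Nielsen–Chuang §4.5.3] [cite: BoykinEtAl1999] -/
def cliffordT_isUniversal : Prop :=
  cliffordT.IsUniversal

/- interim proof relied on results that are now named facts (D-0014); demoted to a fact by the M5 import, proof preserved: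
:=
  ⟨1, cliffordT_generatesDenselyModPhase⟩
-/

/-- The placements on `n` wires of the gates `H`, `T`, `CNOT` of Clifford+T, i.e. of the
sub-gate-set `{H, T, CNOT}` obtained by discarding `S` (`= T²`). (Boykin et al. 1999;
Nielsen–Chuang §4.5.3.) [cite: BoykinEtAl1999] -/
def hTCnotPlacements (n : ℕ) : Set (Matrix (QReg n) (QReg n) ℂ) :=
  {M | ∃ (g : CliffordTOp) (e : Fin (cliffordT.arity g) ↪ Fin n),
    g ≠ CliffordTOp.S ∧ M = placeGate e (cliffordT.mat g)}

/-- `{H, T, CNOT}`-placements are Clifford+T placements. [folklore] -/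
theorem hTCnotPlacements_subset_placements (n : ℕ) :
    hTCnotPlacements n ⊆ placements cliffordT n := by
  rintro M ⟨g, e, -, rfl⟩
  exact ⟨g, e, rfl⟩

/-- **quantum-advantage.S08** (literal form; Boykin–Mor–Pulver–Roychowdhury–Vatan 1999;
Nielsen–Chuang §4.5.3). For every `n ≥ 1`, the placements of the gates `{H, T, CNOT}` on `n`
wires generate a dense subgroup of `U(2^n)` modulo global phase (`T = π/8` gate; `S = T²` and the
whole Clifford group are then generated). [cite: BoykinMorPulverRoychowdhuryVatan1999] -/
def hTCnot_generatesDenselyModPhase : Prop :=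
  ∀ n, 1 ≤ n → GeneratesDenselyModPhase n (hTCnotPlacements n)

end Literature.Computability.QuantumComplexity
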